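import Literature.Topology.FourManifolds.BranchedDoubleCoverTwoKnot
import Mathlib.Topology.Covering.Basic
import HarnessLib

/-!
# Off the knot, a branched double cover of `S⁴` is a 2-sheeted covering map

Topic `Literature/Topology/FourManifolds`; theorems about the relational predicate
`IsBranchedDoubleCover IX X K ι q` of `BranchedDoubleCoverTwoKnot.lean` (the triple `(X, ι, q)`
is the double cover of `S⁴` branched along the 2-knot `K`, with deck involution `ι`).

In Gompf–Stipsicz, *4-Manifolds and Kirby Calculus* (1999), §6.3, a (nonsingular) `d`-fold
branched covering `p : X → Y` with branch locus `B` is required to restrict to an honest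
`d`-fold COVERING `X ∖ p⁻¹(B) → Y ∖ B`; the tree's predicate instead records the point-set
data (`q` a local diffeomorphism and `ι` free off the knot, the fibres of `q` exactly the
`ι`-orbits `{x, ι x}`, `q` onto). This file proves that the two agree: **for a Hausdorff `X`,
`q` is a covering map over the complement of the knot**, with fibre of cardinality two —

* `IsBranchedDoubleCover.isEvenlyCovered` — every `b ∉ K(S²)` is evenly covered by `q` with
  fibre `Bool` (the two sheets over a small `V ∋ b` are `U` and `ι(U)`, where `U` is a domain of
  injectivity of `q` around one preimage `x₁`, shrunk by Hausdorff separation of `x₁` from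
  `ι x₁` so that `U ∩ ι(U) = ∅`; on `U` the inverse is the local inverse of `q`, on `ι(U)` it is
  that followed by `ι`);
* `IsBranchedDoubleCover.isCoveringMapOn` — `IsCoveringMapOn q (range K)ᶜ`;
* `IsBranchedDoubleCover.isCoveringMap_restrictPreimage` — the restriction
  `q⁻¹(S⁴ ∖ K) → S⁴ ∖ K` is a covering map (Mathlib `IsCoveringMap`).

This is the standard lemma "a surjective local homeomorphism with finite fibres of constant
cardinality from a Hausdorff space is a covering" in the case at hand (Gompf–Stipsicz §6.3;
Hatcher, *Algebraic Topology* (2002), §1.3, covering spaces; Bredon (1972), VI.2). No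
definitions besides the auxiliary sheet homeomorphism, no named facts.

## References

* R. E. Gompf, A. I. Stipsicz, *4-Manifolds and Kirby Calculus* (1999), §6.3. [GompfStipsicz1999]
* A. Hatcher, *Algebraic Topology*, CUP (2002), §1.3. [HatcherAT2002]
-/

open scoped Manifold ContDiff Topology
open Function Set

noncomputable section

namespace Literature.Topology.FourManifolds

namespace IsBranchedDoubleCover

/-- Local notation: `𝕊 n` is the unit sphere in `EuclideanSpace ℝ (Fin (n + 1))`. -/
local notation "𝕊 " n:arg => (Metric.sphere (0 : EuclideanSpace ℝ (Fin (n + 1))) 1)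

variable {EX HX : Type*} [NormedAddCommGroup EX] [NormedSpace ℝ EX] [TopologicalSpace HX]
  {IX : ModelWithCorners ℝ EX HX} {X : Type*} [TopologicalSpace X] [ChartedSpace HX X]
  {K : TwoKnot} {ι : X → X} {q : X → 𝕊 4}

/-- Off the knot, `q` agrees near any point with an open partial homeomorphism (from the local
diffeomorphism clause). [cite: GompfStipsicz1999, §6.3] -/
theorem exists_openPartialHomeomorph_eqOn (h : IsBranchedDoubleCover IX X K ι q) {x : X}
    (hx : q x ∉ range K) :
    ∃ e : OpenPartialHomeomorph X (𝕊 4), x ∈ e.source ∧ EqOn q e e.source := by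
  obtain ⟨Φ, hxΦ, heq⟩ := h.isLocalDiffeomorphAt_proj x hx
  exact ⟨Φ.toOpenPartialHomeomorph, hxΦ, heq⟩

/-- The deck involution is a homeomorphism of `X`. [cite: GompfStipsicz1999, §6.3] -/
def deckHomeomorph (h : IsBranchedDoubleCover IX X K ι q) : X ≃ₜ X where
  toFun := ι
  invFun := ι
  left_inv := h.deck_deck
  right_inv := h.deck_deck
  continuous_toFun := h.continuous_deck
  continuous_invFun := h.continuous_deck

/-- The image of a set under the deck involution is its preimage. [folklore] -/
theorem image_deck_eq_preimage (h : IsBranchedDoubleCover IX X K ι q) (U : Set X) :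
    ι '' U = ι ⁻¹' U := by
  ext y
  constructor
  · rintro ⟨u, hu, rfl⟩
    simpa [mem_preimage, h.deck_deck] using hu
  · intro hy
    exact ⟨ι y, hy, h.deck_deck y⟩

/-- The image of an open set under the deck involution is open. [folklore] -/
theorem isOpen_image_deck (h : IsBranchedDoubleCover IX X K ι q) {U : Set X} (hU : IsOpen U) :
    IsOpen (ι '' U) := by
  rw [h.image_deck_eq_preimage]
  exact hU.preimage h.continuous_deck

/-- The fibre of `q` over `b ∉ K(S²)` has exactly two points. [cite: GompfStipsicz1999, §6.3] -/
theorem ncard_preimage_singleton (h : IsBranchedDoubleCover IX X K ι q) {b : 𝕊 4}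
    (hb : b ∉ range K) : (q ⁻¹' {b}).ncard = 2 := by
  obtain ⟨x, rfl⟩ := h.proj_surjective b
  rw [h.preimage_singleton_eq, Set.ncard_pair (h.deck_ne_of_notMem x hb).symm]

section Sheets

variable [T2Space X]

/-- **Sheets over a point off the knot.** For `b ∉ K(S²)` there are an open `V ∋ b`, an open
`U ⊆ X` and an open partial homeomorphism `e` agreeing with `q` on `U ⊆ e.source`, such that
`V = q(U)`, `q⁻¹(V) = U ∪ ι(U)` and `U ∩ ι(U) = ∅` (Hausdorff separation of the two preimages
`x₁ ≠ ι x₁` of `b`). [cite: GompfStipsicz1999, §6.3] -/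
theorem exists_sheets (h : IsBranchedDoubleCover IX X K ι q) {b : 𝕊 4} (hb : b ∉ range K) :
    ∃ (e : OpenPartialHomeomorph X (𝕊 4)) (U : Set X), IsOpen U ∧ U ⊆ e.source ∧
      EqOn q e U ∧ b ∈ e '' U ∧ q ⁻¹' (e '' U) = U ∪ ι '' U ∧ Disjoint U (ι '' U) := by
  obtain ⟨x₁, hx₁⟩ := h.proj_surjective b
  have hK : q x₁ ∉ range K := by rwa [hx₁]
  obtain ⟨e, hxe, heq⟩ := h.exists_openPartialHomeomorph_eqOn hK
  have hne : x₁ ≠ ι x₁ := fun hfix ↦ h.deck_ne_of_notMem x₁ hK hfix.symm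
  obtain ⟨A, B, hA, hB, hxA, hxB, hAB⟩ := t2_separation hne
  set U : Set X := e.source ∩ A ∩ ι ⁻¹' B with hU
  have hUo : IsOpen U := (e.open_source.inter hA).inter (hB.preimage h.continuous_deck)
  have hUs : U ⊆ e.source := fun y hy ↦ hy.1.1
  have hx₁U : x₁ ∈ U := ⟨⟨hxe, hxA⟩, hxB⟩
  have heqU : EqOn q e U := fun y hy ↦ heq (hUs hy)
  refine ⟨e, U, hUo, hUs, heqU, ⟨x₁, hx₁U, by rw [← heq hxe, hx₁]⟩, ?_, ?_⟩
  · ext y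
    simp only [mem_preimage, mem_image, mem_union]
    constructor
    · rintro ⟨u, hu, hqu⟩
      rw [← heqU hu] at hqu
      rcases h.eq_or_eq_deck_of_proj_eq u y hqu.symm with rfl | rfl
      · exact Or.inl hu
      · exact Or.inr ⟨u, hu, rfl⟩
    · rintro (hy | ⟨u, hu, rfl⟩)
      · exact ⟨y, hy, (heqU hy).symm⟩
      · exact ⟨u, hu, by rw [← heqU hu, h.proj_deck]⟩
  · rw [Set.disjoint_left]
    rintro y hyU ⟨u, hu, rfl⟩
    exact Set.disjoint_left.1 hAB hyU.1.2 hu.2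

open Classical in
/-- **The sheet homeomorphism** `q⁻¹(V) ≃ₜ V × Bool` over `V = q(U)` as in `exists_sheets`:
`y ↦ (q y, [y ∈ U])`, with inverse `(v, true) ↦ e⁻¹ v ∈ U`, `(v, false) ↦ ι (e⁻¹ v) ∈ ι(U)`.
[cite: GompfStipsicz1999, §6.3] -/
def sheetHomeomorph (h : IsBranchedDoubleCover IX X K ι q) (e : OpenPartialHomeomorph X (𝕊 4))
    (U : Set X) (hUo : IsOpen U) (hUs : U ⊆ e.source) (heqU : EqOn q e U)
    (hpre : q ⁻¹' (e '' U) = U ∪ ι '' U) (hdis : Disjoint U (ι '' U)) :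
    q ⁻¹' (e '' U) ≃ₜ (e '' U) × Bool where
  toFun y := (⟨q y, y.2⟩, decide ((y : X) ∈ U))
  invFun p := if p.2 then
      ⟨e.symm p.1, by
        obtain ⟨u, hu, hv⟩ := p.1.2
        have hsu : e.symm (p.1 : 𝕊 4) = u := by rw [← hv, e.left_inv (hUs hu)]
        rw [mem_preimage, hsu, heqU hu]
        exact ⟨u, hu, rfl⟩⟩
    else
      ⟨ι (e.symm p.1), by
        obtain ⟨u, hu, hv⟩ := p.1.2
        have hsu : e.symm (p.1 : 𝕊 4) = u := by rw [← hv, e.left_inv (hUs hu)]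
        rw [mem_preimage, hsu, h.proj_deck, heqU hu]
        exact ⟨u, hu, rfl⟩⟩
  left_inv y := by
    by_cases hy : (y : X) ∈ U
    · simp only [hy, decide_true, ↓reduceIte]
      apply Subtype.ext
      change e.symm (q y) = y
      rw [heqU hy, e.left_inv (hUs hy)]
    · simp only [hy, decide_false, Bool.false_eq_true, ↓reduceIte]
      apply Subtype.ext
      have hy' : (y : X) ∈ U ∪ ι '' U := by rw [← hpre]; exact y.2
      obtain ⟨u, hu, huy⟩ := hy'.resolve_left hy
      change ι (e.symm (q y)) = y
      rw [← huy, h.proj_deck, heqU hu, e.left_inv (hUs hu)]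
  right_inv p := by
    obtain ⟨⟨v, u, hu, rfl⟩, b⟩ := p
    have hsu : e.symm (e u) = u := e.left_inv (hUs hu)
    cases b
    · -- `false`: the point `ι u ∉ U`
      have hnot : ι u ∉ U := fun hmem ↦ Set.disjoint_left.1 hdis hmem ⟨u, hu, rfl⟩
      simp only [Bool.false_eq_true, ↓reduceIte, hsu, hnot, decide_false, Prod.mk.injEq,
        and_true]
      apply Subtype.ext
      change q (ι u) = e u
      rw [h.proj_deck, heqU hu]
    · simp only [↓reduceIte, hsu, hu, decide_true, Prod.mk.injEq, and_true]
      apply Subtype.ext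
      change q u = e u
      rw [heqU hu]
  continuous_toFun := by
    refine Continuous.prodMk ?_ ?_
    · exact (h.continuous_proj.comp continuous_subtype_val).subtype_mk _
    · -- the sheet indicator is locally constant: its fibres are `U` and `ι(U)` (both open)
      apply IsLocallyConstant.continuous
      rw [IsLocallyConstant.iff_isOpen_fiber]
      intro b
      cases b
      · have hset : (fun y : q ⁻¹' (e '' U) ↦ decide ((y : X) ∈ U)) ⁻¹' {false} =
            Subtype.val ⁻¹' (ι '' U) := by
          ext y
          simp only [mem_preimage, mem_singleton_iff, decide_eq_false_iff_not]
          have hy' : (y : X) ∈ U ∪ ι '' U := by rw [← hpre]; exact y.2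
          constructor
          · intro hy; exact hy'.resolve_left hy
          · intro hy hyU; exact Set.disjoint_left.1 hdis hyU hy
        rw [hset]
        exact (h.isOpen_image_deck hUo).preimage continuous_subtype_val
      · have hset : (fun y : q ⁻¹' (e '' U) ↦ decide ((y : X) ∈ U)) ⁻¹' {true} =
            Subtype.val ⁻¹' U := by
          ext y
          simp
        rw [hset]
        exact hUo.preimage continuous_subtype_val
  continuous_invFun := by
    have hVt : e '' U ⊆ e.target := fun v ⟨u, hu, hv⟩ ↦ hv ▸ e.map_source (hUs hu)
    have hsymm : Continuous fun v : e '' U ↦ e.symm v :=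
      e.continuousOn_symm.comp_continuous continuous_subtype_val fun v ↦ hVt v.2
    rw [continuous_prod_of_discrete_right]
    intro b
    cases b
    · simp only [Bool.false_eq_true, ↓reduceIte]
      exact (h.continuous_deck.comp hsymm).subtype_mk _
    · simp only [↓reduceIte]
      exact hsymm.subtype_mk _

/-- **Every point off the knot is evenly covered** by `q`, with two sheets.
[cite: GompfStipsicz1999, §6.3] -/
theorem isEvenlyCovered (h : IsBranchedDoubleCover IX X K ι q) {b : 𝕊 4} (hb : b ∉ range K) :
    IsEvenlyCovered q b Bool := by
  obtain ⟨e, U, hUo, hUs, heqU, hbV, hpre, hdis⟩ := h.exists_sheets hb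
  refine ⟨inferInstance, e '' U, hbV, e.isOpen_image_of_subset_source hUo hUs, ?_,
    h.sheetHomeomorph e U hUo hUs heqU hpre hdis, fun y ↦ rfl⟩
  rw [hpre]
  exact hUo.union (h.isOpen_image_deck hUo)

/-- **Off the knot, a branched double cover is a covering map**: `q` is a covering map over
`S⁴ ∖ K(S²)` (Gompf–Stipsicz (1999), §6.3: the defining property of a branched covering away
from the branch locus, here DERIVED from the tree's point-set clauses for Hausdorff `X`).
[cite: GompfStipsicz1999, §6.3] -/
theorem isCoveringMapOn (h : IsBranchedDoubleCover IX X K ι q) : IsCoveringMapOn q (range K)ᶜ :=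
  fun _ hb ↦ (h.isEvenlyCovered hb).to_isEvenlyCovered_preimage

/-- The restriction `q⁻¹(S⁴ ∖ K) → S⁴ ∖ K` is a covering map. [cite: GompfStipsicz1999, §6.3] -/
theorem isCoveringMap_restrictPreimage (h : IsBranchedDoubleCover IX X K ι q) :
    IsCoveringMap ((range K)ᶜ.restrictPreimage q) :=
  h.isCoveringMapOn.isCoveringMap_restrictPreimage

end Sheets

end IsBranchedDoubleCover

end Literature.Topology.FourManifolds
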